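import Summits.RiemannHypothesis.RiemannHypothesis.Theorems.SuzukiStructureFunctionsZetaPair

/-!
# SuzukiStructureFunctionsZetaInversion — Lemma 4.1 of Suzuki JFA21 completed for `ζ`:
# `E_ζ^{ω,ν}(z) = ∫ ϱ_ζ^{ω,ν}(x)e^{izx} dx` on all of `ℂ`, hence `E_ζ^{ω,ν}(0,z) = E_ζ^{ω,ν}(z)` (column DBR; RH-FREE)

LINE 1 — LABEL: RH-FREE (Fourier inversion on a horizontal line for the entire function `ξ(½+ω−iz)^ν`; no zeros, no
positivity); bears_on LADDER-RH B-D → B-P(P1)/(P3). WHAT THIS IS NOT: not progress toward RH; nothing here bears on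
the truth of RH.

Source: M. Suzuki, J. Funct. Anal. 281 (2021) 109116 = arXiv:1606.05726 [Suzuki2021Hamiltonians], Lemma 4.1
(«Taking the Fourier transform of (4.1), we obtain `E_L^{ω,ν}(z) = (𝖥ϱ_L^{ω,ν})(z)`»), Thm. 3.1 (5), Thm. 2.2.

Contents (seat rh-dbr-eng-5 g7; continuation of `…ZetaPair`):
* `invFourierLine_eq_fourierIntegral` — the line transform via Mathlib's `𝓕` (public copy of the tree's helper);
* **`fourier_suzukiRho`** — `𝖥ϱ_ζ^{ω,ν} = E_ζ^{ω,ν}` on ALL of `ℂ` (`ν ≥ 1`);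
* **`suzukiEt_zero_eq_suzukiE`** — `E_ζ^{ω,ν}(0,z) = E_ζ^{ω,ν}(z)`; `suzukiEt_of_nonpos` — `E_ζ^{ω,ν}(t,z) = e^{izt}E_ζ^{ω,ν}(z)`
  for `t ≤ 0`.
-/

noncomputable section

-- D-0017: `Summit.<S>.<S>.…` is the designed namespace of a single-problem summit.
set_option linter.dupNamespace false

open MeasureTheory Set Complex Filter Topology
open scoped ComplexConjugate FourierTransform

namespace Summit.RiemannHypothesis.RiemannHypothesis.Theorems.SuzukiStructureFunctions

open Literature.NumberTheory.LFunctions Literature.NumberTheory.LFunctions.SuzukiStructure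
open scoped Real

/-! ## §13 Lemma 4.1, the Fourier-inversion half: `E_ζ^{ω,ν} = 𝖥ϱ_ζ^{ω,ν}` on all of `ℂ` -/

/-- RH-FREE. Mathlib's inverse Fourier transform on `ℝ` as an explicit exponential integral. -/
theorem fourierInv_real_eq_integral_exp_smul (f : ℝ → ℂ) (w : ℝ) :
    𝓕⁻ f w = ∫ v : ℝ, Complex.exp (↑(2 * π * v * w) * I) • f v := by
  rw [Real.fourierInv_eq_fourier_neg, Real.fourier_real_eq_integral_exp_smul]
  congr 1 with v
  congr 2
  push_cast
  ring

/-- RH-FREE. The line transform in terms of Mathlib's Fourier transform of `φ_b = Φ(· + ib)`: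
`invFourierLine Φ b x = (2π)⁻¹ e^{bx} 𝓕φ_b(x/2π)`. -/
theorem invFourierLine_eq_fourierIntegral (Φ : ℂ → ℂ) (b x : ℝ) :
    invFourierLine Φ b x = (1 : ℂ) / (2 * (Real.pi : ℂ)) *
      (Complex.exp ((b * x : ℝ) : ℂ) * 𝓕 (fun u : ℝ => Φ ((u : ℂ) + (b : ℂ) * I)) (x / (2 * π))) := by
  unfold invFourierLine
  congr 1
  rw [Real.fourier_real_eq_integral_exp_smul, ← integral_const_mul]
  congr 1
  funext u
  have hreal : -2 * π * u * (x / (2 * π)) = -(u * x) := by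
    field_simp
  rw [smul_eq_mul, hreal]
  have hexp : -I * ((u : ℂ) + (b : ℂ) * I) * (x : ℂ) = ((b * x : ℝ) : ℂ) + ((-(u * x) : ℝ) : ℂ) * I := by
    push_cast
    linear_combination (-(b : ℂ) * (x : ℂ)) * I_mul_I
  rw [hexp, Complex.exp_add]
  ring

/-- **RH-FREE · LEMMA 4.1, Fourier-inversion half: `E_ζ^{ω,ν}(z) = ∫ ϱ_ζ^{ω,ν}(x) e^{izx} dx` for EVERY complex `z`**
(`ν ≥ 1`): the structure function `E_ζ^{ω,ν}(z) = ξ(½+ω−iz)^ν` satisfies Suzuki's (K1) with `ϱ = ϱ_ζ^{ω,ν}` of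
(4.1) — Mathlib's Fourier inversion on the line `Im = Im z`, after moving `ϱ`'s defining integral to that line
(`invFourierLine_suzukiE_eq`); integrability of the transform from the super-exponential decay of `ϱ`. -/
theorem fourier_suzukiRho (ω : ℝ) {ν : ℕ} (hν : 1 ≤ ν) (z : ℂ) :
    fourier (suzukiRho ω ν) z = suzukiE ω ν z := by
  set a : ℝ := z.re with ha
  set b : ℝ := z.im with hb
  have hzab : (a : ℂ) + (b : ℂ) * I = z := Complex.re_add_im z
  -- the symbol on the line `Im = b`
  set φ : ℝ → ℂ := fun u => suzukiE ω ν ((u : ℂ) + (b : ℂ) * I) with hφ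
  have hφc : Continuous φ := (differentiable_suzukiE ω ν).continuous.comp (by fun_prop)
  have hφi : Integrable φ := by
    have h := integrable_suzukiE_lineIntegrand ω hν b 0
    refine h.congr (Eventually.of_forall fun u => ?_)
    simp [hφ]
  -- `ϱ` on the line `b`
  set Kc : ℝ → ℂ := fun x => invFourierLine (suzukiE ω ν) b x with hKc
  have hKc_eq : ∀ x : ℝ, (suzukiRho ω ν x : ℂ) = Kc x := fun x => by
    rw [ofReal_suzukiRho, invFourierLine_suzukiE_eq ω hν 0 b x]
  have hdagger : ∀ x : ℝ, Kc x = (1 : ℂ) / (2 * (Real.pi : ℂ)) *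
      (Complex.exp ((b * x : ℝ) : ℂ) * 𝓕 φ (x / (2 * π))) := fun x => invFourierLine_eq_fourierIntegral _ b x
  have hKc_cont : Continuous Kc := by
    have e : Kc = fun x => (suzukiRho ω ν x : ℂ) := by funext x; exact (hKc_eq x).symm
    rw [e]
    exact Complex.continuous_ofReal.comp (continuous_suzukiRho ω hν)
  -- the target integrand
  set G : ℝ → ℂ := fun x => Kc x * Complex.exp (I * z * x) with hG
  have hG_cont : Continuous G := hKc_cont.mul (by fun_prop)
  have hG_int : Integrable G := by
    obtain ⟨C, hC⟩ := abs_suzukiRho_le ω hν (|b| + 1)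
    refine Integrable.mono' ((Literature.Analysis.Complex.integrable_exp_neg_mul_abs one_pos).const_mul C)
      hG_cont.aestronglyMeasurable (Eventually.of_forall fun x => ?_)
    rw [hG]
    simp only [norm_mul, ← hKc_eq x, Complex.norm_real, Real.norm_eq_abs]
    calc |suzukiRho ω ν x| * ‖cexp (I * z * x)‖
        ≤ C * Real.exp (-((|b| + 1) * |x|)) * Real.exp (|z.im| * |x|) :=
          mul_le_mul (hC x) (norm_cexp_I_mul_le z x) (norm_nonneg _) ((abs_nonneg _).trans (hC x))
      _ = C * Real.exp (-1 * |x|) := by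
          rw [mul_assoc, ← Real.exp_add, ← hb]; congr 2; ring
  -- `𝓕 φ` in terms of `G`
  have hπC : (Real.pi : ℂ) ≠ 0 := by exact_mod_cast Real.pi_ne_zero
  have hF_eq : ∀ w : ℝ, 𝓕 φ w = (2 * (Real.pi : ℂ)) * Complex.exp (↑(-2 * π * a * w) * I) * G (2 * π * w) := by
    intro w
    have h1 := hdagger (2 * π * w)
    have hw : 2 * π * w / (2 * π) = w := by field_simp
    rw [hw] at h1
    have h2 : 𝓕 φ w = (2 * (Real.pi : ℂ)) * Complex.exp (-(((b * (2 * π * w) : ℝ)) : ℂ)) * Kc (2 * π * w) := by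
      rw [h1, Complex.exp_neg]
      field_simp
    have key : Complex.exp (-(((b * (2 * π * w) : ℝ)) : ℂ)) =
        Complex.exp (↑(-2 * π * a * w) * I) * Complex.exp (I * z * ↑(2 * π * w)) := by
      rw [← Complex.exp_add]
      congr 1
      rw [← hzab]
      push_cast
      linear_combination (-(2 : ℂ) * (π : ℂ) * (b : ℂ) * (w : ℂ)) * I_mul_I
    rw [h2, hG, key]
    simp only
    ring
  have hF_int : Integrable (𝓕 φ) := by
    have hGs : Integrable fun w : ℝ => G (2 * π * w) := hG_int.comp_mul_left' (by positivity)
    have h := hGs.bdd_mul (f := fun w : ℝ => (2 * (Real.pi : ℂ)) * Complex.exp (↑(-2 * π * a * w) * I))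
      (c := 2 * π) (by fun_prop) (Eventually.of_forall fun w => by
        rw [norm_mul, Complex.norm_exp_ofReal_mul_I, mul_one]
        simp [abs_of_pos Real.pi_pos])
    exact h.congr (Eventually.of_forall fun w => (hF_eq w).symm)
  -- Fourier inversion at the point `a`
  have hinv := congrFun (hφc.fourierInv_fourier_eq hφi hF_int) a
  rw [fourierInv_real_eq_integral_exp_smul] at hinv
  have hint_eq : ∫ v : ℝ, Complex.exp (↑(2 * π * v * a) * I) • 𝓕 φ v =
      ∫ v : ℝ, (2 * (Real.pi : ℂ)) * G (2 * π * v) := by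
    congr 1; funext v
    rw [smul_eq_mul, hF_eq v]
    have key2 : Complex.exp (↑(2 * π * v * a) * I) * Complex.exp (↑(-2 * π * a * v) * I) = 1 := by
      rw [← Complex.exp_add, ← Complex.exp_zero]
      congr 1
      push_cast
      ring
    calc Complex.exp (↑(2 * π * v * a) * I) * ((2 * (Real.pi : ℂ)) * Complex.exp (↑(-2 * π * a * v) * I) *
          G (2 * π * v))
        = (2 * (Real.pi : ℂ)) * (Complex.exp (↑(2 * π * v * a) * I) * Complex.exp (↑(-2 * π * a * v) * I)) *
          G (2 * π * v) := by ring
      _ = (2 * (Real.pi : ℂ)) * G (2 * π * v) := by rw [key2, mul_one]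
  rw [hint_eq, integral_const_mul, MeasureTheory.Measure.integral_comp_mul_left (fun x => G x)] at hinv
  have hπabs : |(2 * π)⁻¹| = (2 * π)⁻¹ := abs_of_pos (by positivity)
  rw [hπabs] at hinv
  have hGint : ∫ x : ℝ, G x = suzukiE ω ν z := by
    rw [← hzab]
    change _ = φ a
    rw [← hinv, Complex.real_smul]
    push_cast
    field_simp
  rw [← hGint, fourier_def, hG]
  congr 1; funext x; rw [hKc_eq x]

/-- **RH-FREE · THM. 3.1 (5) FOR `ζ`, IN SUZUKI'S OWN TERMS: `E_ζ^{ω,ν}(0,z) = E_ζ^{ω,ν}(z) = ξ(½+ω−iz)^ν`**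
(`ω > 0`, `ν ≥ 1`, `νω > 1`): the chain of structure functions built from the kernel `K_ζ^{ω,ν}` starts at
Suzuki's `E_ζ^{ω,ν}` (2.4). -/
theorem suzukiEt_zero_eq_suzukiE {ω : ℝ} (hω : 0 < ω) {ν : ℕ} (hν : 1 ≤ ν) (hνω : 1 < (ν : ℝ) * ω) (z : ℂ) :
    suzukiEt ω ν 0 z = suzukiE ω ν z := by
  rw [suzukiEt_zero hω hν hνω z, fourier_suzukiRho ω hν z]

/-- RH-FREE. `E_ζ^{ω,ν}(t,z) = e^{izt} E_ζ^{ω,ν}(z)` for `t ≤ 0` (the extended Hamiltonian `m = 1` on `t < 0`). -/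
theorem suzukiEt_of_nonpos {ω : ℝ} (hω : 0 < ω) {ν : ℕ} (hν : 1 ≤ ν) (hνω : 1 < (ν : ℝ) * ω) {t : ℝ}
    (ht : t ≤ 0) (z : ℂ) : suzukiEt ω ν t z = cexp (I * z * t) * suzukiE ω ν z := by
  rw [suzukiEt, structE_of_nonpos (isSuzukiPair_zeta hω hν hνω) ht z, fourier_suzukiRho ω hν z]

end Summit.RiemannHypothesis.RiemannHypothesis.Theorems.SuzukiStructureFunctions

end
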